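import Mathlib
import HarnessLib
import Summits.HubbardSuperconductivity.HubbardSuperconductivity.Theorems.KLProgrammeC4aFoldBoxPreLawAllLevels
import Summits.HubbardSuperconductivity.HubbardSuperconductivity.Theorems.KLProgrammeC4aFoldBoxPreLawLinePrimed

/-!
# Route `KLProgramme` — crux C4a, S3 brick (B4) «(U1)-LAWS» part 5i′: the PRE-CAUSTIC (N2) FIRST-ORDER LAW FOR THE PARTNER BAND OVER ALL LOOP LEVELS `|e| ≤ hi` —
# PRIMED SIBLING: two-sided split support ((L2′)) and the flatness row on the bounded range `0 < D ≤ D_fl`, `K₁·Δ ≤ D_fl`, with the slot `+ B_fl` ((L1′))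

Cell `gate-hubbard-kl`, seat hubbard-kl-k3c3-p3 (g33; row «implicit-function / monotonicity route for μ(n)»).  Located brick for the (C)-closer lane / the (M4)
assembly of the umklapp first-order ϑ-layer (stub (C) `stub_twoLeg_curvature` of `KLRegimeEngineV17F2`, stmt-HubbardSuperconductivity-20437), memo
HOME/hubbard-kl-k3c3-p3/U1-CAUSTIC-SUP.md §15; pen rulings (R319)(E)/(R321)(B).

WHY.  Part 5i (`…C4aFoldBoxPreLawAllLevels.intervalIntegral_partnerBand_pre_allLevels_le`) asks the flatness row for EVERY `D > 0` and the split support row for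
EVERY `u ≤ q_s·e`; k3c3-p1's physical family `ppFamilyKernel` (files `…C4aPPKernelFamily*`) delivers flatness for `0 < D ≤ hi/t₁` with an additive `B_fl` for a
Lipschitz `e`-weight, and support on the two-sided zone `|u| ≤ ((1−t₁)/t₁)·e` — and NO `n`-free physical family can do better (located (L1)/(L2)).  The proof of
5i applies the flatness row only at `D = D(y) = e_K(S − Φ(0,y+θ))`, `y` in the loop window, and there
`D(y) ≤ K₁·‖S − 2πm − 2Φ(0,y+θ)‖ ≤ K₁·Δ` (`…PreLawLinePrimed.partnerBand_level_le_mul_norm_caustic` + the caustic budget `Δ` of the box), so ONE threshold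
`K₁·Δ ≤ D_fl` makes the bounded-range row sufficient; the support row goes through part 5c′.  Everything else is part 5i verbatim (5f below the Fermi level, 5g on
the strip, one angle layer, one glue); the slot `B_fl` rides in the angle layer's constant `A₃` as `X₀·B_fl`.
* **`intervalIntegral_partnerBand_pre_allLevels_le'`** (HEADLINE): part 5i's statement with `hqs : 3/2 ≤ q_s`, `hBfl : 0 ≤ B_fl`, `hDfl : K₁·Δ ≤ D_fl`,
  `hsupp : |u| ≤ q_s·e → (K e)′u = 0`, `hflat : ∀ D, 0 < D → D ≤ D_fl → |∫ w·(K e)′(D − e)| ≤ A_fl·lo/max(D,lo)² + B_fl`; conclusion: 5i's with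
  `B = (A₃ + X₀·B_fl)(β − α) + (8A₂/c)·log 2`.
Sizes binder shape + `GeomConstants`; nothing asserts (C), K3 or superconductivity.
References: FST II CPAM 51 (1998) §3 [cite: FeldmanSalmhoferTrubowitz1998]; Salmhofer 1999 §4.5.3 [cite: Salmhofer1999].
-/

noncomputable section

namespace Summit.HubbardSuperconductivity.HubbardSuperconductivity.Theorems.C4a

set_option linter.dupNamespace false -- summit = problem name (single-conjunct summit), D-0017

open Real Set MeasureTheory intervalIntegral
open Literature.MathematicalPhysics.QuantumLattice Literature.MathematicalPhysics.QuantumLattice.BandSectorCounting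
open Literature.MathematicalPhysics.QuantumLattice.FermiRG
open Summit.HubbardSuperconductivity.HubbardSuperconductivity.Theorems.KLRegimeSplit
open Summit.HubbardSuperconductivity.HubbardSuperconductivity.Theorems.DispersionFlow
open Summit.HubbardSuperconductivity.HubbardSuperconductivity.Theorems.PerturbedFermiCurve

section Sizes

variable {K : TrigPolyC4v} {A : ℝ} (hA : ∀ p : Momentum, ∀ j ≤ 2, ‖iteratedFDeriv ℝ j (frameShift K) p‖ ≤ A) (hA20 : A ≤ 1 / 20)
  (hd : klCurveD ≤ (bandBounds (show (-4 : ℝ) < -1.1 by norm_num) (show (-1.1 : ℝ) ≤ -0.1 by norm_num)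
    (show (-0.1 : ℝ) < 0 by norm_num)).Dtmin - 2 * A)
  {μ r : ℝ} (hr : 0 < r) (hlo : (-1.1 : ℝ) < μ - r - A) (hhi : μ + r + A < -0.1)
  {A₃ A₄ : ℝ} (hA₃ : ∀ p : Momentum, ‖iteratedFDeriv ℝ 3 (frameShift K) p‖ ≤ A₃)
  (hA₄ : ∀ p : Momentum, ‖iteratedFDeriv ℝ 4 (frameShift K) p‖ ≤ A₄)
  {K₁ K₂ K₃ : ℝ} (hK₁ : ∀ p : Momentum, ‖fderiv ℝ (frameLevel μ K) p‖ ≤ K₁) (hK₂ : ∀ p : Momentum, ‖iteratedFDeriv ℝ 2 (frameLevel μ K) p‖ ≤ K₂)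
  (hK₃ : ∀ p : Momentum, ‖iteratedFDeriv ℝ 3 (frameLevel μ K) p‖ ≤ K₃)
include hA hA20 hd hr hlo hhi hA₃ hA₄ hK₁ hK₂ hK₃

set_option maxHeartbeats 400000 in
/-- **THE PRE-CAUSTIC (N2) FIRST-ORDER LAW FOR THE PARTNER BAND OVER ALL LOOP LEVELS, PRIMED** (HEADLINE; see the module docstring): part 5i's
`intervalIntegral_partnerBand_pre_allLevels_le` with (L2′) `hqs : 3/2 ≤ q_s`, `hsupp : |u| ≤ q_s·e → (K e)′u = 0` and (L1′) `hflat` quantified over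
`0 < D ≤ D_fl` only, with the slot `+ B_fl`, under the ONE threshold `K₁·Δ ≤ D_fl`; the constant `B` gains `X₀·B_fl·(β − α)`. -/
theorem intervalIntegral_partnerBand_pre_allLevels_le' {Kc r₀ g₀ w : ℝ} (hG : GeomConstants (frameLevel μ K) Kc r₀ g₀ w) (S : Momentum) (m : Fin 2 → ℤ) (θ : ℝ)
    {α β x₀ Wm Wφ Δ lo hi qs K₀ X₀ X₁ W Afl Bfl Dfl Γ Mρ : ℝ} {Kr X : ℝ → ℝ → ℝ} {wt ρ : ℝ → ℝ}
    (hx₀ : x₀ ∈ Icc α β) (hWα : Wm ≤ x₀ - α) (hWβ : Wm ≤ β - x₀) (hWφ : ∀ y ∈ Icc α β, |y - x₀| ≤ Wφ)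
    (hlo0 : 0 < lo) (hlohi : lo ≤ hi) (hhir : hi < r) (hqs : 3 / 2 ≤ qs) (hX₁ : 0 ≤ X₁) (hAfl : 0 ≤ Afl) (hBfl : 0 ≤ Bfl)
    (hK₀ : ∀ p : Momentum, |frameLevel μ K p| ≤ K₀) (hΓ₁ : K₀ ≤ Γ)
    (hΓ₂ : w * (bandBounds (show (-4 : ℝ) < -1.1 by norm_num) (show (-1.1 : ℝ) ≤ -0.1 by norm_num) (show (-0.1 : ℝ) < 0 by norm_num)).umin ^ 2 / 2 * (β - α) ^ 2 ≤ Γ)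
    (hδ₀ : 0 < sInf ((fun x : ℝ => frameLevel μ K (S - levelPoint μ K 0 (x + θ))) '' Icc α β))
    (hwin : ∀ e ∈ Icc (-hi) hi, ∀ y ∈ Icc α β,
      K₃ * (‖S - WithLp.toLp 2 (fun i => 2 * π * (m i : ℝ)) - (levelPoint μ K 0 (x₀ + θ) + levelPoint μ K 0 (x₀ + θ))‖ +
              |e| / ((bandBounds (show (-4 : ℝ) < -1.1 by norm_num) (show (-1.1 : ℝ) ≤ -0.1 by norm_num) (show (-0.1 : ℝ) < 0 by norm_num)).Dtmin - 2 * A) +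
              msD A₃ A₄ 1 * |y - x₀|) * msD A₃ A₄ 1 ^ 2 +
          K₂ * (radialRowOneConst A ((bandBounds (show (-4 : ℝ) < -1.1 by norm_num) (show (-1.1 : ℝ) ≤ -0.1 by norm_num) (show (-0.1 : ℝ) < 0 by norm_num)).Dtmin -
                2 * A) * |e| + msD A₃ A₄ 2 * |y - x₀|) * (msD A₃ A₄ 1 + msD A₃ A₄ 1) +
          K₂ * (‖S - WithLp.toLp 2 (fun i => 2 * π * (m i : ℝ)) - (levelPoint μ K 0 (x₀ + θ) + levelPoint μ K 0 (x₀ + θ))‖ +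
              |e| / ((bandBounds (show (-4 : ℝ) < -1.1 by norm_num) (show (-1.1 : ℝ) ≤ -0.1 by norm_num) (show (-0.1 : ℝ) < 0 by norm_num)).Dtmin - 2 * A) +
              msD A₃ A₄ 1 * |y - x₀|) * msD A₃ A₄ 2 +
          K₁ * ((uRowTwoConst A A₃ ((bandBounds (show (-4 : ℝ) < -1.1 by norm_num) (show (-1.1 : ℝ) ≤ -0.1 by norm_num) (show (-0.1 : ℝ) < 0 by norm_num)).Dtmin -
                  2 * A) +
                1 / ((bandBounds (show (-4 : ℝ) < -1.1 by norm_num) (show (-1.1 : ℝ) ≤ -0.1 by norm_num) (show (-0.1 : ℝ) < 0 by norm_num)).Dtmin - 2 * A) +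
                2 * (radialRowOneConst A ((bandBounds (show (-4 : ℝ) < -1.1 by norm_num) (show (-1.1 : ℝ) ≤ -0.1 by norm_num)
                    (show (-0.1 : ℝ) < 0 by norm_num)).Dtmin - 2 * A) -
                  1 / ((bandBounds (show (-4 : ℝ) < -1.1 by norm_num) (show (-1.1 : ℝ) ≤ -0.1 by norm_num) (show (-0.1 : ℝ) < 0 by norm_num)).Dtmin - 2 * A))) *
              |e| + msD A₃ A₄ 3 * |y - x₀|) ≤
        w * (bandBounds (show (-4 : ℝ) < -1.1 by norm_num) (show (-1.1 : ℝ) ≤ -0.1 by norm_num) (show (-0.1 : ℝ) < 0 by norm_num)).umin ^ 2)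
    (hslope : K₂ * msD A₃ A₄ 1 * (‖S - WithLp.toLp 2 (fun i => 2 * π * (m i : ℝ)) - (2 : ℝ) • levelPoint μ K 0 (x₀ + θ)‖ +
        2 * (hi / ((bandBounds (show (-4 : ℝ) < -1.1 by norm_num) (show (-1.1 : ℝ) ≤ -0.1 by norm_num) (show (-0.1 : ℝ) < 0 by norm_num)).Dtmin - 2 * A))) ≤
      w * (bandBounds (show (-4 : ℝ) < -1.1 by norm_num) (show (-1.1 : ℝ) ≤ -0.1 by norm_num) (show (-0.1 : ℝ) < 0 by norm_num)).umin ^ 2 * Wm)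
    (hrate : K₂ * (‖S - WithLp.toLp 2 (fun i => 2 * π * (m i : ℝ)) - (2 : ℝ) • levelPoint μ K 0 (x₀ + θ)‖ +
          2 * (hi / ((bandBounds (show (-4 : ℝ) < -1.1 by norm_num) (show (-1.1 : ℝ) ≤ -0.1 by norm_num) (show (-0.1 : ℝ) < 0 by norm_num)).Dtmin - 2 * A) +
            msD A₃ A₄ 1 * Wφ)) /
        ((bandBounds (show (-4 : ℝ) < -1.1 by norm_num) (show (-1.1 : ℝ) ≤ -0.1 by norm_num) (show (-0.1 : ℝ) < 0 by norm_num)).Dtmin - 2 * A) ≤ 1 / 2)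
    (hΔ : ‖S - WithLp.toLp 2 (fun i => 2 * π * (m i : ℝ)) - (2 : ℝ) • levelPoint μ K 0 (x₀ + θ)‖ + 2 * (msD A₃ A₄ 1 * Wφ) ≤ Δ) (hΔ1 : Δ ≤ 3 / 10)
    (hΔu : Δ ≤ (bandBounds (show (-4 : ℝ) < -1.1 by norm_num) (show (-1.1 : ℝ) ≤ -0.1 by norm_num) (show (-0.1 : ℝ) < 0 by norm_num)).umin) (hΔr : K₁ * Δ < r)
    (hDfl : K₁ * Δ ≤ Dfl)
    (hK : ∀ e ∈ Icc lo hi, ContDiff ℝ 2 (Kr e)) (hK1 : ∀ e ∈ Icc lo hi, ∀ u, |deriv (Kr e) u| ≤ (max e |u|)⁻¹ ^ 2)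
    (hK2 : ∀ e ∈ Icc lo hi, ∀ u, |iteratedDeriv 2 (Kr e) u| ≤ (max e |u|)⁻¹ ^ 3)
    (hsupp : ∀ e ∈ Icc lo hi, ∀ u, |u| ≤ qs * e → deriv (Kr e) u = 0) (hKc : Continuous fun p : ℝ × ℝ => deriv (Kr p.1) p.2)
    (hflat : ∀ D : ℝ, 0 < D → D ≤ Dfl → |∫ e in lo..hi, wt e * deriv (Kr e) (D - e)| ≤ Afl * (lo / (max D lo) ^ 2) + Bfl)
    (hKn1 : ∀ s ∈ Icc lo hi, ∀ u, s / 2 ≤ u → |deriv (Kr (-s)) u| ≤ ρ s * ((max (u - s) lo)⁻¹ ^ 2))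
    (hρ0 : ∀ s ∈ Icc lo hi, 0 ≤ ρ s) (hρc : ContinuousOn ρ (Icc lo hi))
    (hρtail : ∀ a ∈ Icc lo hi, ∫ s in a..hi, ρ s ≤ Mρ * (lo * (lo / a) ^ 2))
    (hKs1 : ∀ e ∈ Icc (-lo) lo, ∀ u, |deriv (Kr e) u| ≤ (max lo |u|)⁻¹ ^ 2)
    (hwc : ContinuousOn wt (Icc (-hi) hi)) (hw0 : ∀ e ∈ Icc (-hi) hi, 0 ≤ wt e) (hwW : ∀ e ∈ Icc (-hi) hi, wt e ≤ W)
    (hXc : ∀ y ∈ Icc α β, ContinuousOn (fun e => X e y) (Icc (-hi) hi)) (hX0 : ∀ e ∈ Icc (-hi) hi, ∀ y ∈ Icc α β, |X e y| ≤ X₀)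
    (hXL : ∀ e ∈ Icc lo hi, ∀ y ∈ Icc α β, |X e y - X lo y| ≤ X₁ * |e - lo|) :
    ∫ y in α..β, |∫ e in (-hi)..hi, wt e * X e y * deriv (Kr e) (frameLevel μ K (S - levelPoint μ K e (y + θ)))| ≤
      32 * (X₀ * Afl + 5 * (W * X₀ * Mρ) + 32 * (W * X₀)) / (3 * Real.sqrt (w * (bandBounds (show (-4 : ℝ) < -1.1 by norm_num) (show (-1.1 : ℝ) ≤ -0.1 by norm_num) (show (-0.1 : ℝ) < 0 by norm_num)).umin ^ 2 / 2)) *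
          (lo * ((max |sInf ((fun x : ℝ => frameLevel μ K (S - levelPoint μ K 0 (x + θ))) '' Icc α β)| lo)⁻¹ *
            (Real.sqrt (max |sInf ((fun x : ℝ => frameLevel μ K (S - levelPoint μ K 0 (x + θ))) '' Icc α β)| lo))⁻¹)) +
        ((64 * W * (1 / (qs + 1 / 2)) ^ 2 * X₀ *
                (K₂ / ((bandBounds (show (-4 : ℝ) < -1.1 by norm_num) (show (-1.1 : ℝ) ≤ -0.1 by norm_num) (show (-0.1 : ℝ) < 0 by norm_num)).Dtmin - 2 * A)) *
              ((1 / ((bandBounds (show (-4 : ℝ) < -1.1 by norm_num) (show (-1.1 : ℝ) ≤ -0.1 by norm_num) (show (-0.1 : ℝ) < 0 by norm_num)).Dtmin - 2 * A) +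
                  msD A₃ A₄ 1 * (π * (4 + 2 * A) * Kc /
                    ((bandBounds (show (-4 : ℝ) < -1.1 by norm_num) (show (-1.1 : ℝ) ≤ -0.1 by norm_num) (show (-0.1 : ℝ) < 0 by norm_num)).umin * w *
                      ((bandBounds (show (-4 : ℝ) < -1.1 by norm_num) (show (-1.1 : ℝ) ≤ -0.1 by norm_num) (show (-0.1 : ℝ) < 0 by norm_num)).Dtmin - 2 * A) ^ 2))) +
                2 * (1 / (qs + 1 / 2)) /
                  ((bandBounds (show (-4 : ℝ) < -1.1 by norm_num) (show (-1.1 : ℝ) ≤ -0.1 by norm_num) (show (-0.1 : ℝ) < 0 by norm_num)).Dtmin - 2 * A)) +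
            4 * W * (1 / (qs + 1 / 2)) ^ 2 * X₁ + X₀ * Bfl) * (β - α) +
          8 * (128 * W * (1 / (qs + 1 / 2)) ^ 2 * X₀ *
                (K₂ / ((bandBounds (show (-4 : ℝ) < -1.1 by norm_num) (show (-1.1 : ℝ) ≤ -0.1 by norm_num) (show (-0.1 : ℝ) < 0 by norm_num)).Dtmin - 2 * A)) *
              msD A₃ A₄ 1) /
            (w * (bandBounds (show (-4 : ℝ) < -1.1 by norm_num) (show (-1.1 : ℝ) ≤ -0.1 by norm_num) (show (-0.1 : ℝ) < 0 by norm_num)).umin ^ 2 / 2) * Real.log 2) +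
        4 * (128 * W * (1 / (qs + 1 / 2)) ^ 2 * X₀ *
              (K₂ / ((bandBounds (show (-4 : ℝ) < -1.1 by norm_num) (show (-1.1 : ℝ) ≤ -0.1 by norm_num) (show (-0.1 : ℝ) < 0 by norm_num)).Dtmin - 2 * A)) *
            msD A₃ A₄ 1) /
          (w * (bandBounds (show (-4 : ℝ) < -1.1 by norm_num) (show (-1.1 : ℝ) ≤ -0.1 by norm_num) (show (-0.1 : ℝ) < 0 by norm_num)).umin ^ 2 / 2) *
          Real.log (Γ / |sInf ((fun x : ℝ => frameLevel μ K (S - levelPoint μ K 0 (x + θ))) '' Icc α β)|) := by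
  set B := (bandBounds (show (-4 : ℝ) < -1.1 by norm_num) (show (-1.1 : ℝ) ≤ -0.1 by norm_num) (show (-0.1 : ℝ) < 0 by norm_num)) with hBdef
  set v : Momentum := WithLp.toLp 2 (fun i => 2 * π * (m i : ℝ)) with hv
  have hADt : 2 * A < B.Dtmin := by have := klCurveD_pos; linarith
  have hDt : 0 < B.Dtmin - 2 * A := by linarith
  have hK₂0 : 0 ≤ K₂ := (norm_nonneg _).trans (hK₂ 0)
  have hA0 : 0 ≤ A := (norm_nonneg _).trans (hA 0 0 (by norm_num))
  have hKc0 : 0 ≤ Kc := (norm_nonneg _).trans (hG.norm_iteratedFDeriv_le 0 0 (by norm_num))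
  have hu : 0 < B.umin := B.umin_pos
  have hwp : 0 < w := hG.wmin_pos
  have hc₂ : 0 < w * B.umin ^ 2 := by positivity
  have hhi0 : 0 ≤ hi := hlo0.le.trans hlohi
  have hlor : lo < r := lt_of_le_of_lt hlohi hhir
  have h0r : |(0 : ℝ)| < r := by rw [abs_zero]; exact hr
  have h0I : (0 : ℝ) ∈ Icc (-hi) hi := ⟨by linarith, hhi0⟩
  have hM : 0 ≤ msD A₃ A₄ 1 := (norm_nonneg _).trans (norm_iteratedDeriv_levelPoint_le hA hA20 hd hlo hhi hA₃ hA₄ h0r le_rfl (by norm_num) 0)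
  have hαβ : α ≤ β := hx₀.1.trans hx₀.2
  have hloI : lo ∈ Icc (-hi) hi := ⟨by linarith, hlohi⟩
  have hX00 : 0 ≤ X₀ := (abs_nonneg _).trans (hX0 lo hloI x₀ hx₀)
  have hW0 : 0 ≤ W := (hw0 lo hloI).trans (hwW lo hloI)
  have hMρ0 : 0 ≤ Mρ := by
    have h := hρtail lo (left_mem_Icc.2 hlohi)
    rw [div_self hlo0.ne', one_pow, mul_one] at h
    have hρi : IntervalIntegrable ρ volume lo hi := by
      refine ContinuousOn.intervalIntegrable ?_
      rw [uIcc_of_le hlohi]; exact hρc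
    have h0 : 0 ≤ ∫ s in lo..hi, ρ s := intervalIntegral.integral_nonneg hlohi fun s hs => hρ0 s hs
    nlinarith
  -- level-range inclusions
  have hsub_pos : Icc lo hi ⊆ Icc (-hi) hi := Icc_subset_Icc (by linarith) le_rfl
  have hsub_strip : Icc (-lo) lo ⊆ Icc (-hi) hi := Icc_subset_Icc (by linarith) hlohi
  have hneg_mem : ∀ s ∈ Icc lo hi, -s ∈ Icc (-hi) hi := fun s hs => ⟨by linarith [hs.2], by linarith [hs.1, hlo0]⟩
  -- the package
  obtain ⟨vs, hvs, hcurv, hinf, -, -⟩ :=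
    partnerBand_foldBox_package hA hA20 hd hr hlo hhi hA₃ hA₄ hK₁ hK₂ hK₃ hG S m θ hx₀ hWα hWβ hWφ hhi0 hhir hwin hslope hrate
  set δ₀ : ℝ := frameLevel μ K (S - levelPoint μ K 0 (vs 0 + θ)) with hδ₀def
  rw [hinf] at hδ₀ ⊢
  have hg0 : ContDiff ℝ 2 (fun x : ℝ => frameLevel μ K (S - levelPoint μ K 0 (x + θ))) := contDiff_partnerBand_angle hA hd hlo hhi S h0r θ
  have hmin : ∀ y ∈ Icc α β, δ₀ ≤ frameLevel μ K (S - levelPoint μ K 0 (y + θ)) := fun y hy =>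
    le_of_fold_of_convex hg0 (hvs 0 h0I).1 (hvs 0 h0I).2 (fun t ht => hc₂.le.trans (hcurv 0 h0I t ht).1) hy
  -- the quadratic growth of `D(y) = ē(0,y)` away from the fold point
  have hD : ∀ y ∈ Icc α β, δ₀ + w * B.umin ^ 2 / 2 * (y - vs 0) ^ 2 ≤ frameLevel μ K (S - levelPoint μ K 0 (y + θ)) := fun y hy => by
    have h := fold_quadratic (g := fun x : ℝ => frameLevel μ K (S - levelPoint μ K 0 (x + θ))) hg0 (by positivity : 0 < w * B.umin ^ 2 / 2)
      (fun t ht => by have := (hcurv 0 h0I t ht).1; linarith) (hvs 0 h0I).1 (fun t ht => hmin t ht) hy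
    rw [hδ₀def]; linarith
  -- the caustic budget at the fold point
  have hDist : ‖S - v - (2 : ℝ) • levelPoint μ K 0 (vs 0 + θ)‖ ≤ Δ := by
    have h := norm_caustic_sub_two_smul_le hA hA20 hd hlo hhi hA₃ hA₄ S v h0r θ x₀ (vs 0)
    rw [abs_zero, zero_div, zero_add] at h
    have h2 : msD A₃ A₄ 1 * |vs 0 - x₀| ≤ msD A₃ A₄ 1 * Wφ := mul_le_mul_of_nonneg_left (hWφ (vs 0) (hvs 0 h0I).1) hM
    linarith
  -- the rate window along every line of the box, all levels `|σ| ≤ hi`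
  have hrateAll : ∀ y ∈ Icc α β, ∀ σ ∈ Icc (-hi) hi, K₂ * ‖S - v - (2 : ℝ) • levelPoint μ K σ (y + θ)‖ / (B.Dtmin - 2 * A) ≤ 1 / 2 := by
    intro y hy σ hσ
    have hσr : |σ| < r := abs_lt.2 ⟨by linarith [hσ.1], lt_of_le_of_lt hσ.2 hhir⟩
    have hD' := norm_caustic_sub_two_smul_le hA hA20 hd hlo hhi hA₃ hA₄ S v hσr θ x₀ y
    refine le_trans ?_ hrate
    refine div_le_div_of_nonneg_right (mul_le_mul_of_nonneg_left (hD'.trans ?_) hK₂0) hDt.le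
    have h1 : |σ| / (B.Dtmin - 2 * A) ≤ hi / (B.Dtmin - 2 * A) :=
      div_le_div_of_nonneg_right (by rw [abs_le]; constructor <;> linarith [hσ.1, hσ.2]) hDt.le
    have h2 : msD A₃ A₄ 1 * |y - x₀| ≤ msD A₃ A₄ 1 * Wφ := mul_le_mul_of_nonneg_left (hWφ y hy) hM
    linarith
  -- the range of anti-diagonal levels over the box: `D(y) ≤ K₁·Δ ≤ Dfl` ((L1′))
  have hK₁0 : 0 ≤ K₁ := (norm_nonneg _).trans (hK₁ 0)
  have hDfly : ∀ y ∈ Icc α β, frameLevel μ K (S - levelPoint μ K 0 (y + θ)) ≤ Dfl := fun y hy => by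
    have hcau : ‖S - v - (2 : ℝ) • levelPoint μ K 0 (y + θ)‖ ≤ Δ := by
      have h := norm_caustic_sub_two_smul_le hA hA20 hd hlo hhi hA₃ hA₄ S v h0r θ x₀ y
      rw [abs_zero, zero_div, zero_add] at h
      have h2 : msD A₃ A₄ 1 * |y - x₀| ≤ msD A₃ A₄ 1 * Wφ := mul_le_mul_of_nonneg_left (hWφ y hy) hM
      linarith
    have h1 := partnerBand_level_le_mul_norm_caustic hA hr hlo hhi hK₁ S m (y + θ)
    rw [← hv] at h1
    exact (h1.trans (mul_le_mul_of_nonneg_left hcau hK₁0)).trans hDfl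
  -- joint continuity of `∂_uK` for the reflected family
  have hKcn : Continuous fun p : ℝ × ℝ => deriv ((fun s : ℝ => Kr (-s)) p.1) p.2 :=
    hKc.comp (continuous_fst.neg.prodMk continuous_snd)
  -- the per-line law: split the level range and add the three level-line laws
  have hline : ∀ y ∈ Icc α β,
      |∫ e in (-hi)..hi, wt e * X e y * deriv (Kr e) (frameLevel μ K (S - levelPoint μ K e (y + θ)))| ≤
        (X₀ * Afl + 5 * (W * X₀ * Mρ) + 32 * (W * X₀)) * (lo / (max (frameLevel μ K (S - levelPoint μ K 0 (y + θ))) lo) ^ 2) +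
          128 * W * (1 / (qs + 1 / 2)) ^ 2 * X₀ * (K₂ / (B.Dtmin - 2 * A)) * msD A₃ A₄ 1 *
              (|y - vs 0| / frameLevel μ K (S - levelPoint μ K 0 (y + θ))) +
            (64 * W * (1 / (qs + 1 / 2)) ^ 2 * X₀ * (K₂ / (B.Dtmin - 2 * A)) *
                ((1 / (B.Dtmin - 2 * A) + msD A₃ A₄ 1 * (π * (4 + 2 * A) * Kc / (B.umin * w * (B.Dtmin - 2 * A) ^ 2))) + 2 * (1 / (qs + 1 / 2)) / (B.Dtmin - 2 * A)) +
              4 * W * (1 / (qs + 1 / 2)) ^ 2 * X₁ + X₀ * Bfl) := by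
    intro y hy
    have hDy : 0 < frameLevel μ K (S - levelPoint μ K 0 (y + θ)) := hδ₀.trans_le (hmin y hy)
    set f : ℝ → ℝ := fun e => wt e * X e y * deriv (Kr e) (frameLevel μ K (S - levelPoint μ K e (y + θ))) with hf
    -- continuity of the integrand on the tube section
    have hebc : ContinuousOn (fun e : ℝ => frameLevel μ K (S - levelPoint μ K e (y + θ))) (Icc (-hi) hi) := fun e he => by
      have her : |e| < r := abs_lt.2 ⟨by linarith [he.1], lt_of_le_of_lt he.2 hhir⟩
      exact (hasDerivAt_partnerBand_level hA hd hlo hhi S her (y + θ)).continuousAt.continuousWithinAt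
    have hfc : ContinuousOn f (Icc (-hi) hi) := by
      have hd : ContinuousOn (fun e => deriv (Kr e) (frameLevel μ K (S - levelPoint μ K e (y + θ)))) (Icc (-hi) hi) :=
        hKc.comp_continuousOn (continuousOn_id.prodMk hebc)
      exact (hwc.mul (hXc y hy)).mul hd
    have hfi : ∀ a b : ℝ, a ≤ b → Icc a b ⊆ Icc (-hi) hi → IntervalIntegrable f volume a b := fun a b hab hsub => by
      refine ContinuousOn.intervalIntegrable ?_
      rw [uIcc_of_le hab]; exact hfc.mono hsub
    have hi1 := hfi (-hi) (-lo) (by linarith) (Icc_subset_Icc le_rfl (by linarith))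
    have hi2 := hfi (-lo) lo (by linarith) hsub_strip
    have hi3 := hfi lo hi hlohi hsub_pos
    have hsplit : ∫ e in (-hi)..hi, f e = (∫ e in (-hi)..(-lo), f e) + (∫ e in (-lo)..lo, f e) + ∫ e in lo..hi, f e := by
      rw [intervalIntegral.integral_add_adjacent_intervals hi1 hi2, intervalIntegral.integral_add_adjacent_intervals (hi1.trans hi2) hi3]
    have hneg : ∫ e in (-hi)..(-lo), f e = ∫ s in lo..hi, f (-s) := by
      rw [intervalIntegral.integral_comp_neg]
    -- the three level-line laws
    have hpos := abs_levelLine_partnerBand_pre_le' hA hA20 hd hr hlo hhi hA₃ hA₄ hK₁ hK₂ hG S m θ (hvs 0 h0I).2 hδ₀ (hmin y hy) hDist hΔ1 hΔu hΔr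
      hlo0 hlohi hhir hqs hX₁ (fun s hs => hrateAll y hy s ⟨by linarith [hs.1], hs.2⟩) hK hK1 hK2 hsupp hKc (hflat _ hDy (hDfly y hy))
      (hwc.mono hsub_pos) (fun e he => hw0 e (hsub_pos he)) (fun e he => hwW e (hsub_pos he)) ((hXc y hy).mono hsub_pos)
      (fun e he => hX0 e (hsub_pos he) y hy) (fun e he => hXL e he y hy)
    have hbelow := abs_levelLine_partnerBand_pre_below_le hA hd hr hlo hhi hK₂ S m θ (Kr := fun s => Kr (-s)) (X := fun s => X (-s) y)
      (wt := fun s => wt (-s)) hDy hlo0 hlohi hhir (fun σ hσ => hrateAll y hy σ ⟨hσ.1, by linarith [hσ.2]⟩)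
      hKn1 hρ0 hρc hρtail hKcn
      ((hwc.comp continuousOn_neg fun s hs => hneg_mem s hs)) (fun s hs => hw0 (-s) (hneg_mem s hs)) (fun s hs => hwW (-s) (hneg_mem s hs))
      (((hXc y hy).comp continuousOn_neg fun s hs => hneg_mem s hs)) (fun s hs => hX0 (-s) (hneg_mem s hs) y hy)
    have hstrip := abs_levelLine_partnerBand_pre_strip_le hA hd hr hlo hhi hK₂ S m θ (X := fun e => X e y) hDy hlo0 hlor
      (fun σ hσ => hrateAll y hy σ (hsub_strip hσ)) hKs1
      (fun e he => hw0 e (hsub_strip he)) (fun e he => hwW e (hsub_strip he)) (fun e he => hX0 e (hsub_strip he) y hy)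
    -- add up
    rw [hsplit, hneg]
    have htri : |(∫ s in lo..hi, f (-s)) + (∫ e in (-lo)..lo, f e) + ∫ e in lo..hi, f e| ≤
        |∫ s in lo..hi, f (-s)| + |∫ e in (-lo)..lo, f e| + |∫ e in lo..hi, f e| :=
      (abs_add_le _ _).trans (add_le_add (abs_add_le _ _) le_rfl)
    refine htri.trans ?_
    simp only [hf] at hpos hbelow hstrip ⊢
    have hsum := add_le_add (add_le_add hbelow hstrip) hpos
    refine hsum.trans (le_of_eq ?_)
    ring
  -- the angle layer
  have hangle := intervalIntegral_pre_caustic_angle_le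
    (F := fun y => |∫ e in (-hi)..hi, wt e * X e y * deriv (Kr e) (frameLevel μ K (S - levelPoint μ K e (y + θ)))|)
    (D := fun y => frameLevel μ K (S - levelPoint μ K 0 (y + θ)))
    (A₁ := X₀ * Afl + 5 * (W * X₀ * Mρ) + 32 * (W * X₀))
    (A₂ := 128 * W * (1 / (qs + 1 / 2)) ^ 2 * X₀ * (K₂ / (B.Dtmin - 2 * A)) * msD A₃ A₄ 1)
    (A₃ := 64 * W * (1 / (qs + 1 / 2)) ^ 2 * X₀ * (K₂ / (B.Dtmin - 2 * A)) *
        ((1 / (B.Dtmin - 2 * A) + msD A₃ A₄ 1 * (π * (4 + 2 * A) * Kc / (B.umin * w * (B.Dtmin - 2 * A) ^ 2))) + 2 * (1 / (qs + 1 / 2)) / (B.Dtmin - 2 * A)) +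
      4 * W * (1 / (qs + 1 / 2)) ^ 2 * X₁ + X₀ * Bfl)
    (hvs 0 h0I).1 (by positivity : 0 < w * B.umin ^ 2 / 2) hδ₀ hlo0 (by positivity) (by positivity) (by positivity) (fun y _ => abs_nonneg _) hD
    fun y hy => hline y hy
  refine hangle.trans ?_
  -- the glue into the dispatchers' currency
  have hδ₀Γ : δ₀ ≤ Γ := ((le_abs_self _).trans (hK₀ _)).trans hΓ₁
  exact pre_caustic_angle_value_le_dispatch_shape (by positivity : 0 < w * B.umin ^ 2 / 2) hδ₀ hlo0 (by positivity) hαβ hΓ₂ hδ₀Γ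

end Sizes

end Summit.HubbardSuperconductivity.HubbardSuperconductivity.Theorems.C4a

end
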